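import Literature.Analysis.FluidPDE.TaoAveragedCascadeSteps
import Literature.Analysis.FluidPDE.TaoAveragedComplexAverageReal
import Literature.Analysis.FluidPDE.TaoAveragedComplexAverageProofs
import HarnessLib

/-!
# Theorem 3.2 from the six §3.2–§3.9 facts; closure of complex averages of `B` under scalars

T. Tao, *Finite time blowup for an averaged three-dimensional Navier–Stokes equation*,
J. Amer. Math. Soc. **29** (2016), 601–674 = arXiv:1402.0290v3, §3. With the §3.1 facts now
theorems of the tree (`memH10dfC_decomposition_holds` — `TaoAveragedComplexAverageProofs.lean`;
`complexAverage_linear_right_holds` — `TaoAveragedComplexAverageLinear.lean`;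
`complexAverage_isAveraged_holds` — `TaoAveragedComplexAverageReal.lean`) and the proved
assemblies `localCascade_isAveraged_of_complexAverage` (`TaoAveragedComplexAverage.lean`) and
`normalised_isComplexAverage_of_steps` (`TaoAveragedCascadeSteps.lean`), **Theorem 3.2**
(`localCascade_isAveraged`) is reduced to the six named facts of `TaoAveragedCascadeSteps.lean`
(§3.2 ¶2, §3.2 ¶3, §3.3 (two), §3.4, §3.5–3.9): `localCascade_isComplexAverage_of_steps`,
`localCascade_isAveraged_of_steps`.

Also proved here, as the first printed ingredient of `reduction_to_normalised` (§3.2 ¶1: "By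
again using `m_{1,ω}(D)` to absorb scalar factors, we see that if `C` is a complex average of
`C'`, then any complex scalar multiple of `C` is a complex average of `C'`; also, by concatenating
finite measure spaces together … `C₁ + C₂` is a complex average of `C'`. Thus the space of averages
of the Euler bilinear operator is closed under finite linear combinations"), for `C' = B`:
`IsComplexAverageOf.smul_eulerForm` (scaled datum `ComplexAveragingDatum.scale`),
`IsComplexAverageOf.add_eulerForm` (concatenated datum `ComplexAveragingDatum.concat` on
`Ω₁ ⊕ Ω₂`, using the tree's absolute convergence `ComplexAveragingDatum.integrable_eulerForm_slot`)
and `isComplexAverageOf_sum_eulerForm`.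

## References

* T. Tao, J. Amer. Math. Soc. 29 (2016), 601–674, §3 (Thm. 3.2), §3.2 p. 15. Key `Tao2016AveragedNS`.
-/

noncomputable section

open MeasureTheory Set Filter
open scoped ENNReal NNReal

namespace Literature.Analysis.FluidPDE.Tao2016

/-- Local notation for physical / frequency space `ℝ³`. -/
local notation "ℝ³" => EuclideanSpace ℝ (Fin 3)
/-- Local notation for the complexified range `ℂ³`. -/
local notation "ℂ³" => EuclideanSpace ℂ (Fin 3)

/-! ### §3.2 ¶1: complex scalar multiples of complex averages of `B` -/

/-- Seminorm of a complex scalar multiple of a symbol smooth off the origin: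
`‖c m‖_k ≤ |c| ‖m‖_k`. [folklore] -/
theorem symbolSeminorm_const_mul_le {f : ℝ³ → ℂ} (hf : ContDiffOn ℝ ((⊤ : ℕ∞) : WithTop ℕ∞) f {0}ᶜ)
    (c : ℂ) (k : ℕ) : symbolSeminorm k (fun ξ => c * f ξ) ≤ ‖c‖ₑ * symbolSeminorm k f := by
  refine iSup₂_le fun ξ hξ => ?_
  have hfξ : ContDiffAt ℝ k f ξ :=
    ((hf.of_le (by exact_mod_cast le_top)).contDiffAt (isOpen_compl_singleton.mem_nhds hξ))
  have hsmul : iteratedFDeriv ℝ k (fun ξ => c * f ξ) ξ = c • iteratedFDeriv ℝ k f ξ :=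
    iteratedFDeriv_const_smul_apply' (a := c) hfξ
  calc (‖ξ‖₊ : ℝ≥0∞) ^ k * ‖iteratedFDeriv ℝ k (fun ξ => c * f ξ) ξ‖₊
      ≤ (‖ξ‖₊ : ℝ≥0∞) ^ k * (‖c‖₊ * ‖iteratedFDeriv ℝ k f ξ‖₊) := by
        rw [hsmul]
        gcongr
        exact_mod_cast nnnorm_smul_le c (iteratedFDeriv ℝ k f ξ)
    _ = ‖c‖ₑ * ((‖ξ‖₊ : ℝ≥0∞) ^ k * ‖iteratedFDeriv ℝ k f ξ‖₊) := by
        rw [enorm_eq_nnnorm]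
        ring
    _ ≤ ‖c‖ₑ * symbolSeminorm k f := by
        gcongr
        exact le_iSup₂ (f := fun (ξ : ℝ³) (_ : ξ ∈ ({0}ᶜ : Set ℝ³)) =>
          (‖ξ‖₊ : ℝ≥0∞) ^ k * (‖iteratedFDeriv ℝ k f ξ‖₊ : ℝ≥0∞)) ξ hξ

/-- A complex scalar multiple of a complex order-`0` symbol is one. [cite: Tao2016AveragedNS, §3.2 p. 15] -/
theorem IsComplexSymbol.const_mul {m : ℝ³ → ℂ} (hm : IsComplexSymbol m) (c : ℂ) :
    IsComplexSymbol (fun ξ => c * m ξ) :=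
  ⟨contDiffOn_const.mul hm.1, fun k => lt_of_le_of_lt (symbolSeminorm_const_mul_le hm.1 c k)
    (ENNReal.mul_lt_top enorm_lt_top (hm.2 k))⟩

namespace ComplexAveragingDatum

variable (𝒟 : ComplexAveragingDatum)

/-- **The scaled datum** ("using `m_{1,ω}(D)` to absorb scalar factors", §3.2 ¶1): the symbol of
slot `0` multiplied by the complex constant `c`. [cite: Tao2016AveragedNS, §3.2 p. 15] -/
def scale (c : ℂ) : ComplexAveragingDatum where
  Ω := 𝒟.Ω
  μ := 𝒟.μ
  m i θ := if i = 0 then fun ξ => c * 𝒟.m 0 θ ξ else 𝒟.m i θ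
  R := 𝒟.R
  lam := 𝒟.lam
  isComplexSymbol i θ := by
    by_cases hi : i = 0
    · subst hi
      simpa using (𝒟.isComplexSymbol 0 θ).const_mul c
    · simpa [hi] using 𝒟.isComplexSymbol i θ
  det_R := 𝒟.det_R
  lam_pos := 𝒟.lam_pos
  lam_bdd := 𝒟.lam_bdd
  moment k₁ k₂ k₃ := by
    simp only [if_true, show (1 : Fin 3) ≠ 0 by decide, show (2 : Fin 3) ≠ 0 by decide, if_false]
    calc ∫⁻ θ, symbolSeminorm k₁ (fun ξ => c * 𝒟.m 0 θ ξ) * symbolSeminorm k₂ (𝒟.m 1 θ) *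
          symbolSeminorm k₃ (𝒟.m 2 θ) ∂𝒟.μ
        ≤ ∫⁻ θ, ‖c‖ₑ * (symbolSeminorm k₁ (𝒟.m 0 θ) * symbolSeminorm k₂ (𝒟.m 1 θ) *
          symbolSeminorm k₃ (𝒟.m 2 θ)) ∂𝒟.μ := by
          refine lintegral_mono fun θ => ?_
          rw [← mul_assoc, ← mul_assoc]
          gcongr
          exact symbolSeminorm_const_mul_le (𝒟.isComplexSymbol 0 θ).1 c k₁
      _ < ∞ := by
          rw [lintegral_const_mul' _ _ enorm_ne_top]
          exact ENNReal.mul_lt_top enorm_lt_top (𝒟.moment k₁ k₂ k₃)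
  measurable_m i ξ hξ := by
    by_cases hi : i = 0
    · subst hi
      simpa using (𝒟.measurable_m 0 ξ hξ).const_mul c
    · simpa [hi] using 𝒟.measurable_m i ξ hξ
  measurable_R := 𝒟.measurable_R
  measurable_lam := 𝒟.measurable_lam

/-- The `L^∞` class of the scaled symbol. [folklore] -/
theorem scale_symbolLp_zero (c : ℂ) (θ : 𝒟.Ω) :
    (𝒟.scale c).symbolLp 0 θ = c • 𝒟.symbolLp 0 θ := by
  unfold symbolLp
  rw [← MemLp.toLp_const_smul]
  rfl

/-- Slot `0` of the scaled datum is `c` times slot `0`. [cite: Tao2016AveragedNS, §3.2 p. 15] -/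
theorem scale_slot_zero (c : ℂ) (θ : 𝒟.Ω) (u : L2C) :
    (𝒟.scale c).slot 0 θ u = c • 𝒟.slot 0 θ u := by
  unfold slot
  rw [scale_symbolLp_zero, fourierMultiplier_symbol_smul]
  rfl

/-- Slots `1, 2` of the scaled datum are unchanged. [folklore] -/
theorem scale_slot_of_ne_zero (c : ℂ) {i : Fin 3} (hi : i ≠ 0) (θ : 𝒟.Ω) (u : L2C) :
    (𝒟.scale c).slot i θ u = 𝒟.slot i θ u := by
  unfold slot symbolLp
  have h : (𝒟.scale c).m i θ = 𝒟.m i θ := by simp [scale, hi]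
  congr 1
  exact MemLp.toLp_congr _ _ (Eventually.of_forall fun ξ => by rw [h])

/-- The scaled datum averages `B` to `c` times the average. [cite: Tao2016AveragedNS, §3.2 p. 15] -/
theorem scale_average_eulerForm (c : ℂ) (u v w : L2C) :
    (𝒟.scale c).average eulerForm u v w = c * 𝒟.average eulerForm u v w := by
  unfold average
  rw [← integral_const_mul]
  refine integral_congr_ae (Eventually.of_forall fun θ => ?_)
  change eulerForm ((𝒟.scale c).slot 0 θ u) ((𝒟.scale c).slot 1 θ v) ((𝒟.scale c).slot 2 θ w) =
    c * eulerForm (𝒟.slot 0 θ u) (𝒟.slot 1 θ v) (𝒟.slot 2 θ w)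
  rw [scale_slot_zero, 𝒟.scale_slot_of_ne_zero c (show (1 : Fin 3) ≠ 0 by decide),
    𝒟.scale_slot_of_ne_zero c (show (2 : Fin 3) ≠ 0 by decide), eulerForm_smul₁]

end ComplexAveragingDatum

/-- **§3.2 ¶1: complex scalar multiples of complex averages of `B` are complex averages of `B`**
("By again using `m_{1,ω}(D)` to absorb scalar factors …"). [cite: Tao2016AveragedNS, §3.2 p. 15] -/
theorem IsComplexAverageOf.smul_eulerForm {C : L2C → L2C → L2C → ℂ} (hC : IsComplexAverageOf C eulerForm)
    (c : ℂ) : IsComplexAverageOf (fun u v w => c * C u v w) eulerForm := by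
  obtain ⟨𝒟, h𝒟⟩ := hC
  refine ⟨𝒟.scale c, fun u v w hu hv hw => ?_⟩
  change c * C u v w = (𝒟.scale c).average eulerForm u v w
  rw [𝒟.scale_average_eulerForm, h𝒟 u v w hu hv hw]

/-! ### §3.2 ¶1: sums of complex averages of `B` -/

/-- `Sum.inl` is a measurable embedding. [folklore] -/
theorem measurableEmbedding_inl {α β : Type*} [MeasurableSpace α] [MeasurableSpace β] :
    MeasurableEmbedding (Sum.inl : α → α ⊕ β) :=
  ⟨Sum.inl_injective, measurable_inl, fun _ hs => hs.inl_image⟩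

/-- `Sum.inr` is a measurable embedding. [folklore] -/
theorem measurableEmbedding_inr {α β : Type*} [MeasurableSpace α] [MeasurableSpace β] :
    MeasurableEmbedding (Sum.inr : β → α ⊕ β) :=
  ⟨Sum.inr_injective, measurable_inr, fun _ hs => hs.inr_image⟩

namespace ComplexAveragingDatum

variable (𝒟₁ 𝒟₂ : ComplexAveragingDatum)

/-- **Concatenation of two complex averaging data** (§3.2 ¶1: "by concatenating finite measure
spaces together"): sample space `Ω₁ ⊕ Ω₂`, measure `(inl)_* μ₁ + (inr)_* μ₂`, the data of `𝒟₁`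
on the first summand and of `𝒟₂` on the second. [cite: Tao2016AveragedNS, §3.2 p. 15] -/
def concat : ComplexAveragingDatum where
  Ω := 𝒟₁.Ω ⊕ 𝒟₂.Ω
  μ := Measure.map Sum.inl 𝒟₁.μ + Measure.map Sum.inr 𝒟₂.μ
  isFinite := by
    haveI := Measure.isFiniteMeasure_map 𝒟₁.μ (Sum.inl : 𝒟₁.Ω → 𝒟₁.Ω ⊕ 𝒟₂.Ω)
    haveI := Measure.isFiniteMeasure_map 𝒟₂.μ (Sum.inr : 𝒟₂.Ω → 𝒟₁.Ω ⊕ 𝒟₂.Ω)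
    infer_instance
  m i := Sum.elim (𝒟₁.m i) (𝒟₂.m i)
  R i := Sum.elim (𝒟₁.R i) (𝒟₂.R i)
  lam i := Sum.elim (𝒟₁.lam i) (𝒟₂.lam i)
  isComplexSymbol i θ := by
    cases θ with
    | inl θ => exact 𝒟₁.isComplexSymbol i θ
    | inr θ => exact 𝒟₂.isComplexSymbol i θ
  det_R i θ := by
    cases θ with
    | inl θ => exact 𝒟₁.det_R i θ
    | inr θ => exact 𝒟₂.det_R i θ
  lam_pos i θ := by
    cases θ with
    | inl θ => exact 𝒟₁.lam_pos i θ
    | inr θ => exact 𝒟₂.lam_pos i θ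
  lam_bdd := by
    obtain ⟨C₁, hC₁⟩ := 𝒟₁.lam_bdd
    obtain ⟨C₂, hC₂⟩ := 𝒟₂.lam_bdd
    refine ⟨max C₁ C₂, fun i θ => ?_⟩
    cases θ with
    | inl θ =>
      have hpos : 0 < C₁ := (𝒟₁.lam_pos i θ).trans_le (hC₁ i θ).2
      exact ⟨(inv_anti₀ hpos (le_max_left _ _)).trans (hC₁ i θ).1,
        (hC₁ i θ).2.trans (le_max_left _ _)⟩
    | inr θ =>
      have hpos : 0 < C₂ := (𝒟₂.lam_pos i θ).trans_le (hC₂ i θ).2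
      exact ⟨(inv_anti₀ hpos (le_max_right _ _)).trans (hC₂ i θ).1,
        (hC₂ i θ).2.trans (le_max_right _ _)⟩
  moment k₁ k₂ k₃ := by
    rw [lintegral_add_measure, measurableEmbedding_inl.lintegral_map,
      measurableEmbedding_inr.lintegral_map]
    exact ENNReal.add_lt_top.2 ⟨𝒟₁.moment k₁ k₂ k₃, 𝒟₂.moment k₁ k₂ k₃⟩
  measurable_m i ξ hξ := measurable_fun_sum (𝒟₁.measurable_m i ξ hξ) (𝒟₂.measurable_m i ξ hξ)
  measurable_R i x := measurable_fun_sum (𝒟₁.measurable_R i x) (𝒟₂.measurable_R i x)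
  measurable_lam i := measurable_fun_sum (𝒟₁.measurable_lam i) (𝒟₂.measurable_lam i)

/-- Slots of the concatenation on the first summand. [folklore] -/
theorem concat_slot_inl (i : Fin 3) (θ : 𝒟₁.Ω) (u : L2C) :
    (𝒟₁.concat 𝒟₂).slot i (Sum.inl θ) u = 𝒟₁.slot i θ u := rfl

/-- Slots of the concatenation on the second summand. [folklore] -/
theorem concat_slot_inr (i : Fin 3) (θ : 𝒟₂.Ω) (u : L2C) :
    (𝒟₁.concat 𝒟₂).slot i (Sum.inr θ) u = 𝒟₂.slot i θ u := rfl

/-- **The concatenation averages `B` to the sum of the averages** (on `u, v` of finite `H¹⁰`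
norm, where both `θ`-integrands are integrable). [cite: Tao2016AveragedNS, §3.2 p. 15] -/
theorem concat_average_eulerForm {u v : L2C} (hu : FunctionSpaces.eFourierSobolevNorm 10 u < ∞)
    (hv : FunctionSpaces.eFourierSobolevNorm 10 v < ∞) (w : L2C) :
    (𝒟₁.concat 𝒟₂).average eulerForm u v w =
      𝒟₁.average eulerForm u v w + 𝒟₂.average eulerForm u v w := by
  have h1 : Integrable (fun θ : 𝒟₁.Ω ⊕ 𝒟₂.Ω => eulerForm ((𝒟₁.concat 𝒟₂).slot 0 θ u)
      ((𝒟₁.concat 𝒟₂).slot 1 θ v) ((𝒟₁.concat 𝒟₂).slot 2 θ w)) (Measure.map Sum.inl 𝒟₁.μ) :=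
    measurableEmbedding_inl.integrable_map_iff.2 (𝒟₁.integrable_eulerForm_slot w hu hv)
  have h2 : Integrable (fun θ : 𝒟₁.Ω ⊕ 𝒟₂.Ω => eulerForm ((𝒟₁.concat 𝒟₂).slot 0 θ u)
      ((𝒟₁.concat 𝒟₂).slot 1 θ v) ((𝒟₁.concat 𝒟₂).slot 2 θ w)) (Measure.map Sum.inr 𝒟₂.μ) :=
    measurableEmbedding_inr.integrable_map_iff.2 (𝒟₂.integrable_eulerForm_slot w hu hv)
  have key : ∫ θ, eulerForm ((𝒟₁.concat 𝒟₂).slot 0 θ u) ((𝒟₁.concat 𝒟₂).slot 1 θ v)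
        ((𝒟₁.concat 𝒟₂).slot 2 θ w)
        ∂((Measure.map Sum.inl 𝒟₁.μ + Measure.map Sum.inr 𝒟₂.μ : Measure (𝒟₁.Ω ⊕ 𝒟₂.Ω))) =
      𝒟₁.average eulerForm u v w + 𝒟₂.average eulerForm u v w := by
    rw [integral_add_measure h1 h2, measurableEmbedding_inl.integral_map,
      measurableEmbedding_inr.integral_map]
    rfl
  exact key

end ComplexAveragingDatum

/-- **§3.2 ¶1: sums of complex averages of `B` are complex averages of `B`** ("by concatenating
finite measure spaces together we see from Definition 3.4 that if `C₁, C₂` are both complex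
averages of `C'`, then `C₁ + C₂` is a complex average of `C'`"; here `C' = B`, where the
`ω`-integrands converge absolutely, Tao p. 7). [cite: Tao2016AveragedNS, §3.2 p. 15] -/
theorem IsComplexAverageOf.add_eulerForm {C₁ C₂ : L2C → L2C → L2C → ℂ}
    (h₁ : IsComplexAverageOf C₁ eulerForm) (h₂ : IsComplexAverageOf C₂ eulerForm) :
    IsComplexAverageOf (fun u v w => C₁ u v w + C₂ u v w) eulerForm := by
  obtain ⟨𝒟₁, h𝒟₁⟩ := h₁
  obtain ⟨𝒟₂, h𝒟₂⟩ := h₂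
  refine ⟨𝒟₁.concat 𝒟₂, fun u v w hu hv hw => ?_⟩
  change C₁ u v w + C₂ u v w = (𝒟₁.concat 𝒟₂).average eulerForm u v w
  rw [𝒟₁.concat_average_eulerForm 𝒟₂ hu.1 hv.1, h𝒟₁ u v w hu hv hw, h𝒟₂ u v w hu hv hw]

/-- **The zero form is a complex average of `B`** (the zero datum). [folklore] -/
theorem isComplexAverageOf_zero_eulerForm : IsComplexAverageOf (fun _ _ _ => (0 : ℂ)) eulerForm :=
  ⟨AveragingDatum.zero.toComplex, fun u v w _ _ _ => by
    rw [AveragingDatum.toComplex_average_eulerForm, AveragingDatum.zero_form]⟩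

/-- **§3.2 ¶1: "the space of averages of the Euler bilinear operator is closed under finite
linear combinations."** [cite: Tao2016AveragedNS, §3.2 p. 15] -/
theorem isComplexAverageOf_sum_eulerForm {ι : Type*} (s : Finset ι) (c : ι → ℂ)
    (C : ι → L2C → L2C → L2C → ℂ) (h : ∀ j ∈ s, IsComplexAverageOf (C j) eulerForm) :
    IsComplexAverageOf (fun u v w => ∑ j ∈ s, c j * C j u v w) eulerForm := by
  classical
  induction s using Finset.induction_on with
  | empty => simpa using isComplexAverageOf_zero_eulerForm
  | insert a s ha ih =>
    have hrest := ih fun j hj => h j (Finset.mem_insert_of_mem hj)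
    have ha' := (h a (Finset.mem_insert_self a s)).smul_eulerForm (c a)
    have := ha'.add_eulerForm hrest
    simpa [Finset.sum_insert ha] using this

/-! ### Theorem 3.2 from the six steps -/

/-- **`localCascade_isComplexAverage` from the six §3.2–§3.9 facts**: for `ε₀` below the minimum
of the thresholds, every normalised complexified basic operator is a complex average of `B`
(`normalised_isComplexAverage_of_steps`), hence every basic cascade operator is
(`basicCascade_of_normalised`, §3.2 ¶2), hence every finite real combination is (closure under
finite linear combinations, §3.2 ¶1, proved above). [cite: Tao2016AveragedNS, §3.2–3.9] -/
theorem localCascade_isComplexAverage_of_steps (h₁ : singleScale_isComplexAverageNoDil)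
    (h₂ : cascade_of_singleScale) (h₃ : betaForm_isComplexAverage)
    (h₄ : complexAverage_trans) (h₅ : basicCascade_of_normalised)
    (h₆ : betaRhoForm_isComplexAverage) : localCascade_isComplexAverage := by
  obtain ⟨e, he, hnorm⟩ := normalised_isComplexAverage_of_steps h₁ h₂ h₃ h₄ h₆
  obtain ⟨e₅, he₅, h₅⟩ := h₅
  refine ⟨min e e₅, lt_min he he₅, fun ε₀ hε₀ hle k c ψ hψ => ?_⟩
  have hbasic := h₅ ε₀ hε₀ (hle.trans (min_le_right _ _))
    (hnorm ε₀ hε₀ (hle.trans (min_le_left _ _)))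
  exact isComplexAverageOf_sum_eulerForm Finset.univ (fun j => (c j : ℂ))
    (fun j => basicCascadeForm ε₀ (ψ j 0) (ψ j 1) (ψ j 2))
    fun j _ => hbasic _ _ _ (hψ j 0) (hψ j 1) (hψ j 2)

/-- **Tao 2016, Theorem 3.2 from §3.2–§3.9 as named facts**: local cascade operators are
averaged Euler operators, given the six facts of `TaoAveragedCascadeSteps.lean`; the §3.1
inputs (`memH10dfC_decomposition_holds`, `complexAverage_linear_right_holds`,
`complexAverage_isAveraged_holds`) are theorems of the tree. [cite: Tao2016AveragedNS, Thm. 3.2] -/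
theorem localCascade_isAveraged_of_steps (h₁ : singleScale_isComplexAverageNoDil)
    (h₂ : cascade_of_singleScale) (h₃ : betaForm_isComplexAverage)
    (h₄ : complexAverage_trans) (h₅ : basicCascade_of_normalised)
    (h₆ : betaRhoForm_isComplexAverage) : localCascade_isAveraged :=
  localCascade_isAveraged_of_complexAverage memH10dfC_decomposition_holds
    complexAverage_linear_right_holds complexAverage_isAveraged_holds
    (localCascade_isComplexAverage_of_steps h₁ h₂ h₃ h₄ h₅ h₆)

end Literature.Analysis.FluidPDE.Tao2016
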